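import Summits.BirchSwinnertonDyer.BirchSwinnertonDyer.Cruxes.HeegnerTwistCouplingInSupply.SketchIdeasG0

set_option linter.dupNamespace false
set_option autoImplicit false

/-!
# Sketch (crux-ideate seat 1, g20) — first lemma of the CT sharpening `cartier-fulton-trace`
# of the card `frobenius-field-theta-log` for `HeegnerTwistCouplingInSupply` (stmt-21381).

Informal mechanism (not typable today — no modular curves / Cartier operator over `𝔽_p` in Mathlib):
for the twist-core `E₀` of `W = E₀ ⊗ χ_{p*}` (`p ≡ 1 (4)`, `p ∤ N₀`, `a_p(E₀) = 0`) and
`F := θ^{(p−3)/2} f̄_{E₀}` (weight `(p−1)²/2 = k(p−1)`, `k = (p−1)/2`), the Deligne–Fulton–Anderson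
fixed-point formula for `F·Frob*` on `H¹(X₀(N₀)_{𝔽_p}, ω^{−k})` plus Serre duality (dual of Frobenius
= Cartier = `U_p` on `q`-expansions) gives
  `Σ_{y ∈ Y₀(N₀)^{ord}(𝔽_p)} F(y) = − Tr( h ↦ U_p(F·h) | S_{(3p+1)/2}(Γ₀(N₀); 𝔽_p) )`,
and the left side is a sum over reductions of Heegner points of the Frobenius fields
`K'_a = ℚ(√(a²−4p))`, each orbit sum being `u · c(|d'_a|) · log_ω(y_W) (mod p)`; a non-zero trace
therefore produces an admissible Frobenius field with `L(W^{(d'_a)},1) ≠ 0`, which the lemma below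
turns into the crux conclusion. BSD is not proved by this.
-/

noncomputable section

open scoped NumberField Classical
open WeierstrassCurve NumberField
open Literature.NumberTheory.EllipticCurves
open Literature.NumberTheory.EllipticCurves.Rank1Residual

namespace Summit.BirchSwinnertonDyer.BirchSwinnertonDyer.Cruxes.HeegnerTwistCouplingInSupply.SeatOneG20

/-- **CT-transfer (first checkable lemma of the sharpened line).** If the twist-core `W₀` of the
corner curve `W = W₀ ⊗ χ_{p*}` admits ONE Frobenius field `K'` of `p` (`d_{K'} m² = t² − 4p`) with
`|d_{K'}| > 4`, Heegner for `N_{W₀}`, and `L(W^{(d_{K'})}, 1) ≠ 0`, then the conclusion of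
`HeegnerTwistCouplingInSupply` holds for `(W, p)` — with `K'` itself as the witness: `p` splits in a
Frobenius field and `h(d_{K'}) < p` (`FrobeniusFieldAutomatic`), and `N_W = N_{W₀} p²`.
The Cartier–Fulton trace `Tr(U_p ∘ m_F | S_{(3p+1)/2}(Γ₀(N_{W₀}); 𝔽_p)) ≠ 0` is the line's engine
for producing the hypothesis. -/
def CartierTraceTransfer : Prop :=
  ∀ (W₀ : WeierstrassCurve ℚ) [W₀.IsElliptic] (p : ℕ) [Fact p.Prime],
    ¬ p ∣ W₀.conductorNorm ℤ → p % 4 = 1 →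
    ∀ (W : WeierstrassCurve ℚ) [W.IsElliptic] [W.IsGloballyMinimal] [NeZero (W.conductorNorm ℤ)],
      InCorner W p →
      (∃ C : VariableChange ℚ, C • W₀.quadraticTwist ((p : ℤ) : ℚ) = W) →
      (∃ (K : Type) (_ : Field K) (_ : NumberField K),
          IsFrobeniusField p K ∧ 4 < (NumberField.discr K).natAbs ∧
          SatisfiesHeegnerHypothesis (W₀.conductorNorm ℤ) K ∧
          (W.quadraticTwist (NumberField.discr K : ℚ)).entireLFunction 1 ≠ 0) →
      ∃ (K : Type) (_ : Field K) (_ : NumberField K), IsCouplingField W p K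

/-- Sanity: the crux conclusion packaged as `IsCouplingField` is literally the `∃ K, …` of the route
decl (so `CartierTraceTransfer` feeds `HeegnerTwistCouplingInSupply` pointwise in `(W, p)`). -/
example (W : WeierstrassCurve ℚ) (p : ℕ) (K : Type) [Field K] [NumberField K]
    (h : IsCouplingField W p K) :
    IsImaginaryQuadratic K ∧ 4 < (NumberField.discr K).natAbs ∧
      SatisfiesHeegnerHypothesis (W.conductorNorm ℤ) K ∧
      (W.quadraticTwist (NumberField.discr K : ℚ)).entireLFunction 1 ≠ 0 ∧
      ¬ p ∣ NumberField.classNumber K := h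

/-- An `n`-shifted Frobenius field of `p`: `K = ℚ(√(t² − 4pn))` with `p ∤ t` — the CM fields of the
ordinary fixed points of the correspondence `T_n ∘ Frob` on `X₀(N₀)_{𝔽̄_p}` (an endomorphism `ν` of
norm `pn` and trace `t`; `p ∤ t` ⟺ ordinary ⟺ `p` split in `K`). For `n = 1` this is
`IsFrobeniusField`. The n-th coefficient of the F-twisted trace form `G_p` (Hecke upgrade of the
Cartier–Fulton trace) is the signed sum of `F` over these points. -/
def IsShiftedFrobeniusField (p n : ℕ) (K : Type) [Field K] [NumberField K] : Prop :=
  IsImaginaryQuadratic K ∧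
    ∃ t m : ℤ, ¬ (p : ℤ) ∣ t ∧ NumberField.discr K * m ^ 2 = t ^ 2 - 4 * (p : ℤ) * (n : ℤ)

/-- **Shifted CT-transfer.** Same as `CartierTraceTransfer` with the field produced by a non-zero
Hecke-shifted trace `a_n(G_p) = Tr(T_n U_p m_F | S_{(3p+1)/2}) ≠ 0`: an `n`-shifted Frobenius field
`K'` of `p`, Heegner for `N_{W₀}`, `|d_{K'}| > 4`, with `L(W^{(d_{K'})},1) ≠ 0`; here `p ∤ h_{K'}` is no
longer automatic for large `n` and is carried as a hypothesis (free for `n ≲ p / log² p`). -/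
def ShiftedCartierTraceTransfer : Prop :=
  ∀ (W₀ : WeierstrassCurve ℚ) [W₀.IsElliptic] (p n : ℕ) [Fact p.Prime],
    ¬ p ∣ W₀.conductorNorm ℤ → p % 4 = 1 → 0 < n →
    ∀ (W : WeierstrassCurve ℚ) [W.IsElliptic] [W.IsGloballyMinimal] [NeZero (W.conductorNorm ℤ)],
      InCorner W p →
      (∃ C : VariableChange ℚ, C • W₀.quadraticTwist ((p : ℤ) : ℚ) = W) →
      (∃ (K : Type) (_ : Field K) (_ : NumberField K),
          IsShiftedFrobeniusField p n K ∧ 4 < (NumberField.discr K).natAbs ∧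
          ¬ p ∣ NumberField.classNumber K ∧
          SatisfiesHeegnerHypothesis (W₀.conductorNorm ℤ) K ∧
          (W.quadraticTwist (NumberField.discr K : ℚ)).entireLFunction 1 ≠ 0) →
      ∃ (K : Type) (_ : Field K) (_ : NumberField K), IsCouplingField W p K

/-- `n = 1` shifted Frobenius fields are Frobenius fields (and conversely when `p ∤ t`, which is
automatic for `p` split); stated, not proved here. -/
def ShiftOneIsFrobenius : Prop :=
  ∀ (p : ℕ) (K : Type) [Field K] [NumberField K], IsShiftedFrobeniusField p 1 K → IsFrobeniusField p K

example (p : ℕ) (K : Type) [Field K] [NumberField K] (h : IsShiftedFrobeniusField p 1 K)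
    (ht : ∀ t m : ℤ, NumberField.discr K * m ^ 2 = t ^ 2 - 4 * (p : ℤ) * ((1 : ℕ) : ℤ) → t ≠ 0 →
      NumberField.discr K * m ^ 2 = t ^ 2 - 4 * (p : ℤ)) :
    IsFrobeniusField p K := by
  obtain ⟨hK, t, m, hpt, hd⟩ := h
  refine ⟨hK, t, m, ?_, ht t m hd ?_⟩ <;>
  · rintro rfl; exact hpt (dvd_zero _)

end Summit.BirchSwinnertonDyer.BirchSwinnertonDyer.Cruxes.HeegnerTwistCouplingInSupply.SeatOneG20

end
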